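import Summits.CriticalPhenomena.PercolationContinuityZ3.Theorems.Transplant.SkelPhiCorridorKGYReach
import Summits.CriticalPhenomena.PercolationContinuityZ3.Theorems.Transplant.SkelPhiParaFrameChangeFine
import HarnessLib

/-!
# N2 (frames-only node `SamePDropOfSkeletonFrm₁`, OPEN), (C) column: **THE CORRIDOR CHAIN OF THE K-G CORRIDOR OF RECORD WITH THE START-BOX ROW
# DISCHARGED THROUGH THE FINE MAP, SECOND AXIS** — `Skelφ.reachChainF_of_kgCorrY_fine`: `reachChainF_of_kgCorrY` (SkelPhiCorridorKGYReach) with its vertex-form row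
# `hM0` (the arrival cube's frame image lies in the start box) replaced by the cube's FINE FOOTPRINT about `F c₀` (`|F u − F c₀| ≤ (K₀, K₁)`,
# `F = fineSkel φ t₀ A n hs vα vβ c₀′ c₁′ s₀ s₁ D` sharing the run frame's period `n` and shear `hs`) and the frame-change rows `ha hBx hb` of
# `runX_mem_Icc_of_fine` (SkelPhiParaFrameChangeFine p284783) landing in the start box (`bL ≤ q`, `aW ≤ (n ∓ v)⁺ + W`) — N1's Corridor1 :66–:72
# shape.  At hp-8 g40's `cellGeomSG₂bS` the footprint row is `mem_Mb_iff` + `F c₀ = cenS (tgt e)` (three lines, the Geom pen's).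
builds on p205010 (kernel theorem, internal audit signed; external expert review pending) — nothing in this file uses p205010; nothing here is a
claim about the open node `SamePDropOfSkeletonFrm₁`.
Lane `prim-bschramm`, seat `prim-bschramm-p5` (gen 15; (C) lineage); helper file (`--supports stmt-CriticalPhenomena-4575 --as helper`).
[cite: KozmaNitzan2024, §4 Lemma 12 (pp. 23–25), p. 31] [cite: MartineauTassion2017, §4.3 Lemma 4.2]
-/

noncomputable section

open scoped Classical

namespace Summit.CriticalPhenomena.PercolationContinuityZ3.Theorems

namespace Transplant

open MeasureTheory ProbabilityTheory
open scoped ENNReal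

namespace Skelφ

open Literature.Probability.Percolation Literature.Probability.LatticeModels SimpleGraph GadgetSystem ProbeHistory HSiteScheme Contour KNCells
open KNCells.KSchA KNLevels ChainPlanar ChainPara
open Literature.Barriers.CriticalPhenomena (graphBall graphBall_mono)
open Skel (winGraph winGraphIn winGraphIn_le)
open SkelI (tanOff)
open TwoAxis.Para (modulus)

variable {V : Type} [DecidableEq V] [Countable V] {G : SimpleGraph V} [G.LocallyFinite] {φ : V → Site 2}

/-- **THE CORRIDOR CHAIN OF THE SECOND-AXIS K-G CORRIDOR OF RECORD, START-BOX ROW THROUGH THE FINE MAP.** [cite: KozmaNitzan2024, §4 Lemma 12 (pp. 23–25), p. 31]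
[this work] -/
theorem reachChainF_of_kgCorrY_fine
    -- the scheme, the probe
    {S : KSchA V ℕ} {FD : FaceData V ℕ} {LD : LevelData V ℕ}
    (hL : LevelGeom G S.Γ FD LD) (hQ : QSepGeom G S.Γ) (hSt : StepsGeom S.Γ FD) (hEx : ExitGeom G S.Γ)
    {h : ProbeHistory V} {e : Site 2 × MDir} (hV : S.Valid₂O G h e) {a' : ℕ} (ha' : a' ∈ S.Γ.anchSet (S.aOf₁O G h e) (tgt e))
    {du : MDir} (hdu : du ∈ S.onwardO G h (tgt e))
    -- the skeleton map, the frame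
    (hlipφ : Lip G φ) (hstep : Steps G φ) {Δ : ℕ} (hΔ : ∀ v, G.degree v ≤ Δ) {types : Finset V} (hfr : Frames G φ types) (hκ : CylConn G φ types)
    {n ℓ : ℕ} {hs v : ℤ} (hn : 1 ≤ n) (hv : |v| ≤ n) (hlay : (n + hs.natAbs : ℕ) ≤ (n : ℤ) * ℓ + 1) (c₀ : V) {σ : ℤ} (hσ : σ = 1 ∨ σ = -1)
    {kq : ℕ} (hκL : hs.natAbs ≤ kq * n)
    -- the corridor of record
    {R' ρ qq W N m₁ Wm₂ Wp₂ m₂ : ℕ}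
    (hP₁ : ParkOK (kgPark₁Y n ℓ hs v R' ρ qq W N m₁)) (hP₂ : ParkOK (kgPark₂Y n ℓ hs v R' ρ qq W N m₁ Wm₂ Wp₂ m₂))
    (hsplit : (Wm₂ : ℤ) + Wp₂ = (kgPark₁Y n ℓ hs v R' ρ qq W N m₁).aHi (m₁ + 1) - ParkPrm.aLo (kgPark₁Y n ℓ hs v R' ρ qq W N m₁) (m₁ + 1))
    -- the window
    {w₀ : V} {R r Rl : ℕ} (hr : Rl ≤ r) (hrR : r ≤ R)
    -- kit constants
    (Pk : ApronPrm) {Mz Rs KCmax rs cS cU : ℕ} (hPN : kq + 3 ≤ Pk.N) (hA : Pk.A = (Mz + 1 : ℕ) * (shearUnit n hs : ℤ) + 1)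
    (hdD : Pk.d + 2 ≤ shellD Pk) (hDρ : Rs + 1 ≤ shellD Pk) (hKCmax : (shellD Pk + Mz + 1) * (kq + 1) ≤ KCmax)
    (hT : (shellD Pk : ℤ) + KCmax + Rs ≤ tanOff Pk.ℓs Pk.M)
    (hr₀ : Pk.N * (tanOff Pk.ℓs Pk.M + 2) + Pk.N * Pk.d + (KCmax + Rs) ≤ Pk.r₀) (hR : Pk.r₀ ≤ R) (hr₀1 : 1 ≤ Pk.r₀)
    (hrs : 1 + (Pk.N * (tanOff Pk.ℓs Pk.M + 2) + Pk.N * Pk.d + (KCmax + Rs)) ≤ rs)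
    (hcS : (Pk.N + 1) * (tanOff Pk.ℓs Pk.M + 1) + (Pk.N + 1) * Pk.d + (KCmax + 1) + cU ≤ cS)
    (hreach : r + (Pk.N * (tanOff Pk.ℓs Pk.M + 1) + Pk.N * Pk.d + KCmax) ≤ Pk.r₀)
    -- the short region and the zone datum
    (Rg : V → Finset V) (hRg : ∀ c, ∀ u ∈ Rg c, u ∈ graphBall G c Rs) (hRgcard : ∀ c, (Rg c).card ≤ cU) (hcU1 : 1 ≤ cU)
    (Λc : V → ℕ → Finset V) (kz : ℕ) (hΛRg : ∀ c, Λc c kz ⊆ Rg c) (hzconn : ∀ c, ∀ s ∈ Λc c kz, PathIn G (↑(Λc c kz) : Set V) c s)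
    (hcz : ∀ c, c ∈ Λc c kz) {Rk : ℕ} (hkz : 1 ≤ kz) (hRk : cylRadMax G φ types kz (2 * KCmax) ≤ Rk) (hΛcyl : ∀ c, cylBallFin G φ c kz Rk ⊆ Λc c kz)
    -- the chain data
    (Pd : WinChainData V) (hPo : Pd.o = S.Γ.root) (hPS : Pd.Sfin = S.Sx G h e (S.aOf₁O G h e) a' du)
    (hj0 : tanOff Pk.ℓs Pk.M ≤ Pd.j₀) (hj : Pd.j₁ ≤ Pd.Rlev) (hRl : Pd.Rlev + 1 ≤ R')
    (hE : Pd.j₁ + (Pk.N * (tanOff Pk.ℓs Pk.M + 1) + Pk.N * Pk.d + KCmax) ≤ R')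
    {Δ' : ℕ} {δ η : ℝ} (hδ : 0 < δ) (hη : η ≤ δ / 2)
    (kk : ℕ) (hN : kk * (Δ + 1) ^ (2 * rs) ≤ Pd.N) (hk : (1 - (S.p : ℝ) ^ (1 + Δ * cS + cS * cU)) ^ kk ≤ δ)
    (hcount : 1 / (1 - (S.p : ℝ)) ^ (Δ' * Pd.N) ≤ δ * ((Finset.Icc Pd.j₀ Pd.j₁).card : ℝ))
    -- the habitat rows (vertex form) at `Ω := Ewv (aOf₁O) e.1 e.2 ∪ Hfull a' (tgt e) du`
    (hΩball : ∀ u ∈ graphBall G w₀ R, runX φ c₀ n hs σ u ∈ (kgCorrSchedY hn hv hlay hP₁ hP₂ hsplit).prism →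
      u ∈ S.Γ.Ewv (S.aOf₁O G h e) e.1 e.2 ∪ FD.Hfull a' (tgt e) du)
    (hreg : ∀ k ≤ (kgCorrSchedY hn hv hlay hP₁ hP₂ hsplit).N, ∀ u ∈ S.Γ.Ewv (S.aOf₁O G h e) e.1 e.2 ∪ FD.Hfull a' (tgt e) du,
      runX φ c₀ n hs σ u ∈ (kgCorrSchedY hn hv hlay hP₁ hP₂ hsplit).region k → u ∈ S.Γ.Q (S.aOf₁O G h e) (tgt e) ∪ S.Γ.Efar a' (tgt e) du)
    (hRim : ∀ k, Pd.Rim k ⊆ WinIn (runX φ c₀ n hs σ) (S.Γ.Ewv (S.aOf₁O G h e) e.1 e.2 ∪ FD.Hfull a' (tgt e) du) ((kgCorrSchedY hn hv hlay hP₁ hP₂ hsplit).region k))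
    (hcover : ∀ k ≤ (kgCorrSchedY hn hv hlay hP₁ hP₂ hsplit).N,
      ∀ u ∈ WinIn (runX φ c₀ n hs σ) (S.Γ.Ewv (S.aOf₁O G h e) e.1 e.2 ∪ FD.Hfull a' (tgt e) du) ((kgCorrSchedY hn hv hlay hP₁ hP₂ hsplit).region k),
        u ∉ graphBall G w₀ (R - Pk.r₀) → u ∈ Pd.Rim k)
    (hTne : ∀ k ≤ (kgCorrSchedY hn hv hlay hP₁ hP₂ hsplit).N,
      (WinIn (runX φ c₀ n hs σ) (S.Γ.Ewv (S.aOf₁O G h e) e.1 e.2 ∪ FD.Hfull a' (tgt e) du) (ScheduleNP.core (kgCorrSchedY hn hv hlay hP₁ hP₂ hsplit) (k + 1))).Nonempty)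
    -- the arrival cube's FINE footprint about `F c₀` (`F = fineSkel …` sharing the frame's `n, hs`) and the frame change into the start box
    {A : ℤ} (hAp : 0 < A) {vα vβ : ℤ} (hm : 0 < modulus n hs vα vβ) {c₀' c₁' s₀ s₁ D : ℤ} (hc₀' : 0 < c₀') (hc₁' : 0 < c₁') (hDp : 0 < D)
    (t₀ : V) {K₀ K₁ : ℕ}
    (hM0f : ∀ u ∈ S.Γ.M (S.aOf₁O G h e) (tgt e),
      |fineSkel φ t₀ A n hs vα vβ c₀' c₁' s₀ s₁ D u 0 - fineSkel φ t₀ A n hs vα vβ c₀' c₁' s₀ s₁ D c₀ 0| ≤ K₀ ∧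
      |fineSkel φ t₀ A n hs vα vβ c₀' c₁' s₀ s₁ D u 1 - fineSkel φ t₀ A n hs vα vβ c₀' c₁' s₀ s₁ D c₀ 1| ≤ K₁)
    {aW Bx bL : ℤ} (ha : D * (c₁' * (n : ℤ) * (K₀ + 1) + c₀' * |vα| * (K₁ + 1)) ≤ c₀' * c₁' * A * modulus n hs vα vβ * aW)
    (hBx : D * ((K₁ : ℤ) + 1) ≤ c₁' * A * Bx) (hb : Bx / (shearUnit n hs : ℤ) + 1 ≤ bL)
    (hbq : bL ≤ qq) (haWm : aW ≤ (((n + v).toNat + W : ℕ) : ℤ)) (haWp : aW ≤ (((n - v).toNat + W : ℕ) : ℤ))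
    (hlastM : ∀ u ∈ S.Γ.Ewv (S.aOf₁O G h e) e.1 e.2 ∪ FD.Hfull a' (tgt e) du,
      runX φ c₀ n hs σ u ∈ ScheduleNP.core (kgCorrSchedY hn hv hlay hP₁ hP₂ hsplit) ((kgCorrSchedY hn hv hlay hP₁ hP₂ hsplit).N + 1) → u ∈ S.Γ.M a' (tgt e + stepVec du))
    (hexc : ∀ k ≤ (kgCorrSchedY hn hv hlay hP₁ hP₂ hsplit).N,
      (prodBernoulli (S.Wcor G FD h e (S.aOf₁O G h e) a' du)).real (⋃ t' ∈ Pd.Rim k, openConn S.Γ.root t') ≤ η)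
    -- THE LONG LINKS AT EVERY CENTRE at accuracy `δ³`
    (hlong : ∀ c (τ : ℤ), τ = 1 ∨ τ = -1 → 1 - δ ^ 3 < (bondPercolation G S.p).real
      (linkIn (pgramPrism G φ c n hs (3 * ℓ) Rl) (Λc c kz) (pgSideHalfW G φ c n hs ℓ Rl σ (σ * τ))))
    (hlongY : ∀ c (τ : ℤ), τ = 1 ∨ τ = -1 → 1 - δ ^ 3 < (bondPercolation G S.p).real
      (linkIn (pgramPrism G φ c n hs (3 * ℓ) Rl) (Λc c kz) (pgTopPieceW G φ c n hs ℓ Rl σ τ v)))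
    -- the budget
    {nmax : ℕ} (hnmax : (kgCorrSchedY hn hv hlay hP₁ hP₂ hsplit).N ≤ nmax) :
    ∃ (n₀ : ℕ) (_ : n₀ ≤ nmax) (Ω : Finset V) (s : Fin (n₀ + 1) → KNLevels.TStep (winGraphIn G Ω)) (T' : Fin (n₀ + 1) → Finset V) (η' : ℝ),
      (∀ i : Fin (n₀ + 1), (s i).L.o = S.Γ.root) ∧
      (∀ i : Fin n₀, T' (Fin.castSucc i) ⊆ (s i.succ).L.X 0) ∧ (∀ i : Fin (n₀ + 1), T' i ⊆ (s i).T) ∧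
      (∀ i : Fin (n₀ + 1), (s i).KitsAtF (S.Wcor G FD h e (S.aOf₁O G h e) a' du) S.p Δ' δ) ∧ η' ≤ δ / 2 ∧
      (∀ i : Fin (n₀ + 1), (prodBernoulli (S.Wcor G FD h e (S.aOf₁O G h e) a' du)).real (⋃ t ∈ (s i).T \ T' i, openConn S.Γ.root t) ≤ η') ∧
      S.Γ.M (S.aOf₁O G h e) (tgt e) ⊆ (s 0).L.X 0 ∧
      T' (Fin.last n₀) ⊆ S.Γ.M a' (tgt e + stepVec du) :=
  reachChainF_of_kgCorrY hL hQ hSt hEx hV ha' hdu hlipφ hstep hΔ hfr hκ hn hv hlay c₀ hσ hκL hP₁ hP₂ hsplit hr hrR Pk hPN hA hdD hDρ hKCmax hT hr₀ hR hr₀1 hrs hcS hreach Rg hRg hRgcard hcU1 Λc kz hΛRg hzconn hcz hkz hRk hΛcyl Pd hPo hPS hj0 hj hRl hE hδ hη kk hN hk hcount hΩball hreg hRim hcover hTne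
    (fun u hu => by
      obtain ⟨h0, h1⟩ := hM0f u hu
      have hbox := runX_mem_Icc_of_fine (s₀ := s₀) (s₁ := s₁) hAp hn hm hc₀' hc₁' hDp t₀ c₀ u hσ h0 h1 ha hBx hb
      rw [mem_kgCorrSchedY_core_zero]
      rw [Finset.mem_Icc, Pi.le_def, Pi.le_def, Fin.forall_fin_two, Fin.forall_fin_two] at hbox
      simp only [Pi.neg_apply, Matrix.cons_val_zero, Matrix.cons_val_one] at hbox
      exact ⟨⟨by linarith [hbox.1.2], by linarith [hbox.2.2]⟩, by linarith [hbox.1.1], by linarith [hbox.2.1]⟩)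
    hlastM hexc hlong hlongY hnmax

end Skelφ

end Transplant

end Summit.CriticalPhenomena.PercolationContinuityZ3.Theorems

end
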